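import Summits.ValiantsHypothesis.ValiantsHypothesis.Theorems.LacunarySymmetroidMatrixDescartesPivotRankOneOneThreeKillEight
import Summits.ValiantsHypothesis.ValiantsHypothesis.Theorems.LacunarySymmetroidMatrixDescartesPivotRankOneOneThreeKillEightPairs

/-!
# `MatrixDescartes` census — rank-one `(2,4)₁`, split 1/3, chamber (C): the weight-free circuit TRIPLE «N01 ∨ N02 ∨ C_J»

HONEST FRAMING.  Object-search cell `pub-symmetroid`, seat `val-sym-mdr-p1` (generation 16); helper file `--supports` the crux item
stmt-ValiantsHypothesis-18050 (`Theses.LacunarySymmetroid.MatrixDescartes`, OPEN, on HOLD) with NO closure claim.  A conditional kernel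
theorem («condition ⇒ Z₊ ≤ 8») for chamber (C) of the 1/3 split `d₀ < e < d₁ < d₂ < d₃`; no covering theorem for (C) is claimed.
Nothing here bears on `MatrixDescartes` in its window, on `DoorA26` / `DoorA34`, registers / credences, or `VP ≠ VNP`.

WHAT IS NEW.  Second extreme ray of the Farkas cone of the eight chamber-(C) circuit normals (seat memo NULL-DIRECTION.md §4; the first,
«N12 ∨ C₃», is `…PivotRankOneOneThreeCircuitPair`).  The three kernel circuits around the pivot degree `c = 2e` — (N01) on
`(s₀, p₀₁, c)`, (N02) on `(c, p₀₂, s₁)` (both `…KillEightPairs`) and (C_J) on `(p₀₁, c, p₀₂)` (`…OneThreeKillEight`) — have weight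
normals (in `log w`) `(d₁−e, e−d₀, 0, 0)`, `(d₁−e, 2e−d₀−d₂, d₁−e, 0)`, `(d₁−d₂, 2e−d₀−d₂, d₀+d₁−2e, 0)` with the positive dependency
`(d₀+d₂−2e)·N01 + (2e−d₀−d₁)·N02 + (d₁−e)·C_J = 0`; hence the product of the three circuit inequalities raised to these (chamber-positive,
exponent-dependent) powers is WEIGHT-FREE, and «product ⇒ Z₊ ≤ 8» for every choice of weights (`elevenNomial_chamberC_N01N02CJ_le_eight`,
matrix form `oneThree_rankOne_posRoots_le_eight_of_N01N02CJ`): either (N01) or (N02) holds, or both fail and then (C_J) holds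
(`circuitRay_transfer_three`).  The hypothesis is stated in the cancelled form; the kernel certifies the cancellation (`ring` on symbolic exponents).

[folklore] Only real-number bookkeeping on top of the three cited kernel theorems.  No definitions, no named facts.
-/

-- `Summit.ValiantsHypothesis.ValiantsHypothesis.…` repeats a component by the D-0017 layout
-- (single-conjunct summit), which the `dupNamespace` linter flags; the name is mandated.
set_option linter.dupNamespace false

namespace Summit.ValiantsHypothesis.ValiantsHypothesis.Theorems.LacunarySymmetroidMatrixDescartes.Pivot.TwoDirections.BlockLaw

open Polynomial Matrix Finset
open scoped BigOperators

/-- **Ray transfer (three circuits).**  If two of three inequalities fail (`R₁ ≤ L₁`, `R₂ ≤ L₂`, everything non-negative) while the product of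
all three raised to powers `m₁, m₂, m₃` holds strictly, then the third holds: `L₃ < R₃`. [folklore] -/
theorem circuitRay_transfer_three {L₁ R₁ L₂ R₂ L₃ R₃ : ℝ} {m₁ m₂ m₃ : ℕ} (hL₁ : 0 ≤ L₁) (hL₂ : 0 ≤ L₂)
    (hR₁ : 0 ≤ R₁) (hR₂ : 0 ≤ R₂) (hR₃ : 0 ≤ R₃) (h₁ : R₁ ≤ L₁) (h₂ : R₂ ≤ L₂)
    (key : L₁ ^ m₁ * L₂ ^ m₂ * L₃ ^ m₃ < R₁ ^ m₁ * R₂ ^ m₂ * R₃ ^ m₃) : L₃ < R₃ := by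
  have hA : R₁ ^ m₁ * R₂ ^ m₂ ≤ L₁ ^ m₁ * L₂ ^ m₂ :=
    mul_le_mul (pow_le_pow_left₀ hR₁ h₁ _) (pow_le_pow_left₀ hR₂ h₂ _) (pow_nonneg hR₂ _) (pow_nonneg hL₁ _)
  have hB : R₁ ^ m₁ * R₂ ^ m₂ * R₃ ^ m₃ ≤ L₁ ^ m₁ * L₂ ^ m₂ * R₃ ^ m₃ := mul_le_mul_of_nonneg_right hA (pow_nonneg hR₃ _)
  have hC : L₁ ^ m₁ * L₂ ^ m₂ * L₃ ^ m₃ < L₁ ^ m₁ * L₂ ^ m₂ * R₃ ^ m₃ := key.trans_le hB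
  have hD : L₃ ^ m₃ < R₃ ^ m₃ := lt_of_mul_lt_mul_left hC (mul_nonneg (pow_nonneg hL₁ _) (pow_nonneg hL₂ _))
  exact lt_of_pow_lt_pow_left₀ m₃ hR₃ hD

/-- **Circuit triple «N01 ∨ N02 ∨ C_J» of chamber (C), real form.**  If the weight-free product of the (N01), (N02), (C_J) circuit
inequalities raised to the powers `d₀+d₂−2e`, `2e−d₀−d₁`, `d₁−e` holds, then one of the three circuits applies and `Z₊ ≤ 8`. [this file] -/
theorem elevenNomial_chamberC_N01N02CJ_le_eight (e d₀ d₁ d₂ d₃ : ℕ) (h0e : d₀ < e) (he1 : e < d₁) (h12 : d₁ < d₂) (h23 : d₂ < d₃)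
    (hC1 : d₀ + d₁ < 2 * e) (hC2 : 2 * e < d₀ + d₂) (hC3 : d₀ + d₂ < e + d₁) (hC4 : e + d₁ < d₀ + d₃) (hC5 : d₀ + d₃ < e + d₂) (hC6 : d₁ + d₂ < e + d₃)
    (dJ m₀ m₁ m₂ m₃ w₀ w₁ w₂ w₃ D01 D02 D03 D12 D13 D23 : ℝ) (hw₀ : 0 < w₀) (hw₁ : 0 < w₁) (hw₂ : 0 < w₂) (hm₀ : m₀ < 0) (hm₁ : m₁ < 0)
    (hdJ : dJ < 0) (hD01 : 0 < D01) (hD02 : 0 < D02)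
    (hcomb : ((D01 * (((e : ℝ) - d₀) * ((e : ℝ) + d₂ - d₀ - d₁) * ((e : ℝ) + d₃ - d₀ - d₁) * ((d₂ : ℝ) - d₁) * ((d₃ : ℝ) - d₁) * ((d₂ : ℝ) - d₀) * ((d₃ : ℝ) - d₀) * ((d₂ : ℝ) + d₃ - d₀ - d₁))) ^ (d₁ - e + (2 * e - (d₀ + d₁))) * ((((2 * e - (d₀ + d₁) : ℕ) : ℝ)) ^ (2 * e - (d₀ + d₁)) * (((d₁ - e : ℕ) : ℝ)) ^ (d₁ - e))) ^ (d₀ + d₂ - 2 * e) * ((D02 * (((d₂ : ℝ) - e) * ((e : ℝ) - d₀) * ((e : ℝ) + d₃ - d₀ - d₂) * ((d₂ : ℝ) - d₁) * ((d₃ : ℝ) - d₂) * ((d₁ : ℝ) - d₀) * ((d₁ : ℝ) + d₃ - d₀ - d₂) * ((d₃ : ℝ) - d₀))) ^ (d₀ + d₂ - 2 * e + (e + d₁ - (d₀ + d₂))) * ((((e + d₁ - (d₀ + d₂) : ℕ) : ℝ)) ^ (e + d₁ - (d₀ + d₂)) * (((d₀ + d₂ - 2 * e : ℕ) : ℝ))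 ^ (d₀ + d₂ - 2 * e))) ^ (2 * e - (d₀ + d₁)) * (((-dJ) * (((e : ℝ) - d₀) * ((d₁ : ℝ) - e) * ((d₂ : ℝ) - e) * ((d₃ : ℝ) - e) * ((d₀ : ℝ) + d₃ - 2 * e) * ((d₁ : ℝ) + d₂ - 2 * e) * ((d₁ : ℝ) + d₃ - 2 * e) * ((d₂ : ℝ) + d₃ - 2 * e))) ^ (2 * e - d₀ - d₁ + ((d₀ + d₂) - 2 * e)) * (((((d₀ + d₂) - 2 * e : ℕ) : ℝ)) ^ ((d₀ + d₂) - 2 * e) * (((2 * e - d₀ - d₁ : ℕ) : ℝ)) ^ (2 * e - d₀ - d₁))) ^ (d₁ - e)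
      < ((((d₁ - e + (2 * e - (d₀ + d₁)) : ℕ) : ℝ)) ^ (d₁ - e + (2 * e - (d₀ + d₁))) * (((-m₀) * (((d₁ : ℝ) - d₀) * ((d₂ : ℝ) - d₀) * ((d₃ : ℝ) - d₀) * ((d₂ : ℝ) - e) * ((d₃ : ℝ) - e) * ((d₁ : ℝ) + d₂ - e - d₀) * ((d₁ : ℝ) + d₃ - e - d₀) * ((d₂ : ℝ) + d₃ - e - d₀))) ^ (2 * e - (d₀ + d₁)) * ((-dJ) * (((d₁ : ℝ) - e) * ((d₂ : ℝ) - e) * ((d₃ : ℝ) - e) * ((d₀ : ℝ) + d₂ - 2 * e) * ((d₀ : ℝ) + d₃ - 2 * e) * ((d₁ : ℝ) + d₂ - 2 * e) * ((d₁ : ℝ) + d₃ - 2 * e) * ((d₂ : ℝ) + d₃ - 2 * e))) ^ (d₁ - e))) ^ (d₀ + d₂ - 2 * e) * ((((d₀ + d₂ - 2 * e + (e + d₁ - (d₀ + d₂)) : ℕ) : ℝ)) ^ (d₀ + d₂ - 2 * e + (e + d₁ - (d₀ + d₂))) * (((-dJ) * (((e : ℝ) - d₀) * ((d₂ : ℝ)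 - e) * ((d₃ : ℝ) - e) * ((2 : ℝ) * e - d₀ - d₁) * ((d₀ : ℝ) + d₃ - 2 * e) * ((d₁ : ℝ) + d₂ - 2 * e) * ((d₁ : ℝ) + d₃ - 2 * e) * ((d₂ : ℝ) + d₃ - 2 * e))) ^ (e + d₁ - (d₀ + d₂)) * ((-m₁) * (((d₁ : ℝ) - d₀) * ((d₂ : ℝ) - d₁) * ((d₃ : ℝ) - d₁) * ((e : ℝ) - d₀) * ((d₀ : ℝ) + d₃ - e - d₁) * ((d₂ : ℝ) - e) * ((d₃ : ℝ) - e) * ((d₂ : ℝ) + d₃ - e - d₁))) ^ (d₀ + d₂ - 2 * e))) ^ (2 * e - (d₀ + d₁)) * ((((2 * e - d₀ - d₁ + ((d₀ + d₂) - 2 * e) : ℕ) : ℝ)) ^ (2 * e - d₀ - d₁ + ((d₀ + d₂) - 2 * e)) * ((D01 * (((d₁ : ℝ) - e) * ((e : ℝ) - d₀) * ((e : ℝ) + d₂ - d₀ - d₁) * ((e : ℝ) + d₃ - d₀ - d₁) * ((d₃ : ℝ) - d₁) * ((d₂ : ℝ) - d₀) * ((d₃ : ℝ) - d₀) * ((d₂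 : ℝ) + d₃ - d₀ - d₁))) ^ ((d₀ + d₂) - 2 * e) * (D02 * (((d₂ : ℝ) - e) * ((e : ℝ) + d₁ - d₀ - d₂) * ((e : ℝ) - d₀) * ((e : ℝ) + d₃ - d₀ - d₂) * ((d₃ : ℝ) - d₂) * ((d₁ : ℝ) - d₀) * ((d₁ : ℝ) + d₃ - d₀ - d₂) * ((d₃ : ℝ) - d₀))) ^ (2 * e - d₀ - d₁))) ^ (d₁ - e)) :
    ((∑ i : Fin 11, Polynomial.C ((![dJ, w₀ * m₀, w₁ * m₁, w₂ * m₂, w₃ * m₃, w₀ * w₁ * D01, w₀ * w₂ * D02, w₀ * w₃ * D03, w₁ * w₂ * D12, w₁ * w₃ * D13, w₂ * w₃ * D23] : Fin 11 → ℝ) i) * X ^ ((![2 * e, e + d₀, e + d₁, e + d₂, e + d₃, d₀ + d₁, d₀ + d₂, d₀ + d₃, d₁ + d₂, d₁ + d₃, d₂ + d₃] : Fin 11 → ℕ) i)).roots.toFinset.filter (fun t => 0 < t)).card ≤ 8 := by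
  classical
  rcases lt_or_ge ((w₀ * w₁ * D01 * (((e : ℝ) - d₀) * ((e : ℝ) + d₂ - d₀ - d₁) * ((e : ℝ) + d₃ - d₀ - d₁) * ((d₂ : ℝ) - d₁) * ((d₃ : ℝ) - d₁) * ((d₂ : ℝ) - d₀) * ((d₃ : ℝ) - d₀) * ((d₂ : ℝ) + d₃ - d₀ - d₁))) ^ (d₁ - e + (2 * e - (d₀ + d₁))) * ((((2 * e - (d₀ + d₁) : ℕ) : ℝ)) ^ (2 * e - (d₀ + d₁)) * (((d₁ - e : ℕ) : ℝ)) ^ (d₁ - e))) ((((d₁ - e + (2 * e - (d₀ + d₁)) : ℕ) : ℝ)) ^ (d₁ - e + (2 * e - (d₀ + d₁))) * ((w₀ * (-m₀) * (((d₁ : ℝ) - d₀) * ((d₂ : ℝ) - d₀) * ((d₃ : ℝ) - d₀) * ((d₂ : ℝ) - e) * ((d₃ : ℝ) - e) * ((d₁ : ℝ) + d₂ - e - d₀) * ((d₁ : ℝ) + d₃ - e - d₀) * ((d₂ : ℝ) + d₃ - e - d₀))) ^ (2 * e - (d₀ + d₁)) * ((-dJ) * (((d₁ : ℝ) - e) *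 ((d₂ : ℝ) - e) * ((d₃ : ℝ) - e) * ((d₀ : ℝ) + d₂ - 2 * e) * ((d₀ : ℝ) + d₃ - 2 * e) * ((d₁ : ℝ) + d₂ - 2 * e) * ((d₁ : ℝ) + d₃ - 2 * e) * ((d₂ : ℝ) + d₃ - 2 * e))) ^ (d₁ - e))) with hN1 | hN1
  · exact elevenNomial_chamberC_N01_le_eight e d₀ d₁ d₂ d₃ h0e he1 h12 h23 hC1 hC2 hC3 hC4 hC5 hC6 dJ m₀ m₁ m₂ m₃ w₀ w₁ w₂ w₃ D01 D02
      D03 D12 D13 D23 hw₀ hm₀ hdJ hN1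
  rcases lt_or_ge ((w₀ * w₂ * D02 * (((d₂ : ℝ) - e) * ((e : ℝ) - d₀) * ((e : ℝ) + d₃ - d₀ - d₂) * ((d₂ : ℝ) - d₁) * ((d₃ : ℝ) - d₂) * ((d₁ : ℝ) - d₀) * ((d₁ : ℝ) + d₃ - d₀ - d₂) * ((d₃ : ℝ) - d₀))) ^ (d₀ + d₂ - 2 * e + (e + d₁ - (d₀ + d₂))) * ((((e + d₁ - (d₀ + d₂) : ℕ) : ℝ)) ^ (e + d₁ - (d₀ + d₂)) * (((d₀ + d₂ - 2 * e : ℕ) : ℝ)) ^ (d₀ + d₂ - 2 * e))) ((((d₀ + d₂ - 2 * e + (e + d₁ - (d₀ + d₂)) : ℕ) : ℝ)) ^ (d₀ + d₂ - 2 * e + (e + d₁ - (d₀ + d₂))) * (((-dJ) * (((e : ℝ) - d₀) * ((d₂ : ℝ) - e) * ((d₃ : ℝ) - e) * ((2 : ℝ) * e - d₀ - d₁) * ((d₀ : ℝ) + d₃ - 2 * e) * ((d₁ : ℝ) + d₂ - 2 * e) * ((d₁ : ℝ) + d₃ - 2 * e) * ((d₂ : ℝ) + d₃ - 2 * e)))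 ^ (e + d₁ - (d₀ + d₂)) * (w₁ * (-m₁) * (((d₁ : ℝ) - d₀) * ((d₂ : ℝ) - d₁) * ((d₃ : ℝ) - d₁) * ((e : ℝ) - d₀) * ((d₀ : ℝ) + d₃ - e - d₁) * ((d₂ : ℝ) - e) * ((d₃ : ℝ) - e) * ((d₂ : ℝ) + d₃ - e - d₁))) ^ (d₀ + d₂ - 2 * e))) with hN2 | hN2
  · exact elevenNomial_chamberC_N02_le_eight e d₀ d₁ d₂ d₃ h0e he1 h12 h23 hC1 hC2 hC3 hC4 hC5 hC6 dJ m₀ m₁ m₂ m₃ w₀ w₁ w₂ w₃ D01 D02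
      D03 D12 D13 D23 hw₁ hdJ hm₁ hN2
  have h0e' : (d₀ : ℝ) < e := by exact_mod_cast h0e
  have he1' : (e : ℝ) < d₁ := by exact_mod_cast he1
  have h12' : (d₁ : ℝ) < d₂ := by exact_mod_cast h12
  have h23' : (d₂ : ℝ) < d₃ := by exact_mod_cast h23
  have hC1' : (d₀ : ℝ) + d₁ < 2 * e := by exact_mod_cast hC1
  have hC2' : 2 * (e : ℝ) < d₀ + d₂ := by exact_mod_cast hC2
  have hC3' : (d₀ : ℝ) + d₂ < e + d₁ := by exact_mod_cast hC3
  have hC4' : (e : ℝ) + d₁ < d₀ + d₃ := by exact_mod_cast hC4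
  have hC5' : (d₀ : ℝ) + d₃ < e + d₂ := by exact_mod_cast hC5
  have hC6' : (d₁ : ℝ) + d₂ < e + d₃ := by exact_mod_cast hC6
  have hPB1 : 0 < (((e : ℝ) - d₀) * ((e : ℝ) + d₂ - d₀ - d₁) * ((e : ℝ) + d₃ - d₀ - d₁) * ((d₂ : ℝ) - d₁) * ((d₃ : ℝ) - d₁) * ((d₂ : ℝ) - d₀) * ((d₃ : ℝ) - d₀) * ((d₂ : ℝ) + d₃ - d₀ - d₁)) := by
    have f1 : 0 < ((e : ℝ) - d₀) := by linarith only [h0e', he1', h12', h23', hC1', hC2', hC3', hC4', hC5', hC6']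
    have f2 : 0 < ((e : ℝ) + d₂ - d₀ - d₁) := by linarith only [h0e', he1', h12', h23', hC1', hC2', hC3', hC4', hC5', hC6']
    have f3 : 0 < ((e : ℝ) + d₃ - d₀ - d₁) := by linarith only [h0e', he1', h12', h23', hC1', hC2', hC3', hC4', hC5', hC6']
    have f4 : 0 < ((d₂ : ℝ) - d₁) := by linarith only [h0e', he1', h12', h23', hC1', hC2', hC3', hC4', hC5', hC6']
    have f5 : 0 < ((d₃ : ℝ) - d₁) := by linarith only [h0e', he1', h12', h23', hC1', hC2', hC3', hC4', hC5', hC6']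
    have f6 : 0 < ((d₂ : ℝ) - d₀) := by linarith only [h0e', he1', h12', h23', hC1', hC2', hC3', hC4', hC5', hC6']
    have f7 : 0 < ((d₃ : ℝ) - d₀) := by linarith only [h0e', he1', h12', h23', hC1', hC2', hC3', hC4', hC5', hC6']
    have f8 : 0 < ((d₂ : ℝ) + d₃ - d₀ - d₁) := by linarith only [h0e', he1', h12', h23', hC1', hC2', hC3', hC4', hC5', hC6']
    exact mul_pos (mul_pos (mul_pos (mul_pos (mul_pos (mul_pos (mul_pos f1 f2) f3) f4) f5) f6) f7) f8
  have hPB2 : 0 < (((d₂ : ℝ) - e) * ((e : ℝ) - d₀) * ((e : ℝ) + d₃ - d₀ - d₂) * ((d₂ : ℝ) - d₁) * ((d₃ : ℝ) - d₂) * ((d₁ : ℝ) - d₀) * ((d₁ : ℝ) + d₃ - d₀ - d₂) * ((d₃ : ℝ) - d₀)) := by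
    have f1 : 0 < ((d₂ : ℝ) - e) := by linarith only [h0e', he1', h12', h23', hC1', hC2', hC3', hC4', hC5', hC6']
    have f2 : 0 < ((e : ℝ) - d₀) := by linarith only [h0e', he1', h12', h23', hC1', hC2', hC3', hC4', hC5', hC6']
    have f3 : 0 < ((e : ℝ) + d₃ - d₀ - d₂) := by linarith only [h0e', he1', h12', h23', hC1', hC2', hC3', hC4', hC5', hC6']
    have f4 : 0 < ((d₂ : ℝ) - d₁) := by linarith only [h0e', he1', h12', h23', hC1', hC2', hC3', hC4', hC5', hC6']
    have f5 : 0 < ((d₃ : ℝ) - d₂) := by linarith only [h0e', he1', h12', h23', hC1', hC2', hC3', hC4', hC5', hC6']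
    have f6 : 0 < ((d₁ : ℝ) - d₀) := by linarith only [h0e', he1', h12', h23', hC1', hC2', hC3', hC4', hC5', hC6']
    have f7 : 0 < ((d₁ : ℝ) + d₃ - d₀ - d₂) := by linarith only [h0e', he1', h12', h23', hC1', hC2', hC3', hC4', hC5', hC6']
    have f8 : 0 < ((d₃ : ℝ) - d₀) := by linarith only [h0e', he1', h12', h23', hC1', hC2', hC3', hC4', hC5', hC6']
    exact mul_pos (mul_pos (mul_pos (mul_pos (mul_pos (mul_pos (mul_pos f1 f2) f3) f4) f5) f6) f7) f8
  have hPA1 : 0 < (((d₁ : ℝ) - d₀) * ((d₂ : ℝ) - d₀) * ((d₃ : ℝ) - d₀) * ((d₂ : ℝ) - e) * ((d₃ : ℝ) - e) * ((d₁ : ℝ) + d₂ - e - d₀) * ((d₁ : ℝ) + d₃ - e - d₀) * ((d₂ : ℝ) + d₃ - e - d₀)) := by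
    have f1 : 0 < ((d₁ : ℝ) - d₀) := by linarith only [h0e', he1', h12', h23', hC1', hC2', hC3', hC4', hC5', hC6']
    have f2 : 0 < ((d₂ : ℝ) - d₀) := by linarith only [h0e', he1', h12', h23', hC1', hC2', hC3', hC4', hC5', hC6']
    have f3 : 0 < ((d₃ : ℝ) - d₀) := by linarith only [h0e', he1', h12', h23', hC1', hC2', hC3', hC4', hC5', hC6']
    have f4 : 0 < ((d₂ : ℝ) - e) := by linarith only [h0e', he1', h12', h23', hC1', hC2', hC3', hC4', hC5', hC6']
    have f5 : 0 < ((d₃ : ℝ) - e) := by linarith only [h0e', he1', h12', h23', hC1', hC2', hC3', hC4', hC5', hC6']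
    have f6 : 0 < ((d₁ : ℝ) + d₂ - e - d₀) := by linarith only [h0e', he1', h12', h23', hC1', hC2', hC3', hC4', hC5', hC6']
    have f7 : 0 < ((d₁ : ℝ) + d₃ - e - d₀) := by linarith only [h0e', he1', h12', h23', hC1', hC2', hC3', hC4', hC5', hC6']
    have f8 : 0 < ((d₂ : ℝ) + d₃ - e - d₀) := by linarith only [h0e', he1', h12', h23', hC1', hC2', hC3', hC4', hC5', hC6']
    exact mul_pos (mul_pos (mul_pos (mul_pos (mul_pos (mul_pos (mul_pos f1 f2) f3) f4) f5) f6) f7) f8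
  have hPC1 : 0 < (((d₁ : ℝ) - e) * ((d₂ : ℝ) - e) * ((d₃ : ℝ) - e) * ((d₀ : ℝ) + d₂ - 2 * e) * ((d₀ : ℝ) + d₃ - 2 * e) * ((d₁ : ℝ) + d₂ - 2 * e) * ((d₁ : ℝ) + d₃ - 2 * e) * ((d₂ : ℝ) + d₃ - 2 * e)) := by
    have f1 : 0 < ((d₁ : ℝ) - e) := by linarith only [h0e', he1', h12', h23', hC1', hC2', hC3', hC4', hC5', hC6']
    have f2 : 0 < ((d₂ : ℝ) - e) := by linarith only [h0e', he1', h12', h23', hC1', hC2', hC3', hC4', hC5', hC6']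
    have f3 : 0 < ((d₃ : ℝ) - e) := by linarith only [h0e', he1', h12', h23', hC1', hC2', hC3', hC4', hC5', hC6']
    have f4 : 0 < ((d₀ : ℝ) + d₂ - 2 * e) := by linarith only [h0e', he1', h12', h23', hC1', hC2', hC3', hC4', hC5', hC6']
    have f5 : 0 < ((d₀ : ℝ) + d₃ - 2 * e) := by linarith only [h0e', he1', h12', h23', hC1', hC2', hC3', hC4', hC5', hC6']
    have f6 : 0 < ((d₁ : ℝ) + d₂ - 2 * e) := by linarith only [h0e', he1', h12', h23', hC1', hC2', hC3', hC4', hC5', hC6']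
    have f7 : 0 < ((d₁ : ℝ) + d₃ - 2 * e) := by linarith only [h0e', he1', h12', h23', hC1', hC2', hC3', hC4', hC5', hC6']
    have f8 : 0 < ((d₂ : ℝ) + d₃ - 2 * e) := by linarith only [h0e', he1', h12', h23', hC1', hC2', hC3', hC4', hC5', hC6']
    exact mul_pos (mul_pos (mul_pos (mul_pos (mul_pos (mul_pos (mul_pos f1 f2) f3) f4) f5) f6) f7) f8
  have hPA2 : 0 < (((e : ℝ) - d₀) * ((d₂ : ℝ) - e) * ((d₃ : ℝ) - e) * ((2 : ℝ) * e - d₀ - d₁) * ((d₀ : ℝ) + d₃ - 2 * e) * ((d₁ : ℝ) + d₂ - 2 * e) * ((d₁ : ℝ) + d₃ - 2 * e) * ((d₂ : ℝ) + d₃ - 2 * e)) := by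
    have f1 : 0 < ((e : ℝ) - d₀) := by linarith only [h0e', he1', h12', h23', hC1', hC2', hC3', hC4', hC5', hC6']
    have f2 : 0 < ((d₂ : ℝ) - e) := by linarith only [h0e', he1', h12', h23', hC1', hC2', hC3', hC4', hC5', hC6']
    have f3 : 0 < ((d₃ : ℝ) - e) := by linarith only [h0e', he1', h12', h23', hC1', hC2', hC3', hC4', hC5', hC6']
    have f4 : 0 < ((2 : ℝ) * e - d₀ - d₁) := by linarith only [h0e', he1', h12', h23', hC1', hC2', hC3', hC4', hC5', hC6']
    have f5 : 0 < ((d₀ : ℝ) + d₃ - 2 * e) := by linarith only [h0e', he1', h12', h23', hC1', hC2', hC3', hC4', hC5', hC6']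
    have f6 : 0 < ((d₁ : ℝ) + d₂ - 2 * e) := by linarith only [h0e', he1', h12', h23', hC1', hC2', hC3', hC4', hC5', hC6']
    have f7 : 0 < ((d₁ : ℝ) + d₃ - 2 * e) := by linarith only [h0e', he1', h12', h23', hC1', hC2', hC3', hC4', hC5', hC6']
    have f8 : 0 < ((d₂ : ℝ) + d₃ - 2 * e) := by linarith only [h0e', he1', h12', h23', hC1', hC2', hC3', hC4', hC5', hC6']
    exact mul_pos (mul_pos (mul_pos (mul_pos (mul_pos (mul_pos (mul_pos f1 f2) f3) f4) f5) f6) f7) f8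
  have hPC2 : 0 < (((d₁ : ℝ) - d₀) * ((d₂ : ℝ) - d₁) * ((d₃ : ℝ) - d₁) * ((e : ℝ) - d₀) * ((d₀ : ℝ) + d₃ - e - d₁) * ((d₂ : ℝ) - e) * ((d₃ : ℝ) - e) * ((d₂ : ℝ) + d₃ - e - d₁)) := by
    have f1 : 0 < ((d₁ : ℝ) - d₀) := by linarith only [h0e', he1', h12', h23', hC1', hC2', hC3', hC4', hC5', hC6']
    have f2 : 0 < ((d₂ : ℝ) - d₁) := by linarith only [h0e', he1', h12', h23', hC1', hC2', hC3', hC4', hC5', hC6']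
    have f3 : 0 < ((d₃ : ℝ) - d₁) := by linarith only [h0e', he1', h12', h23', hC1', hC2', hC3', hC4', hC5', hC6']
    have f4 : 0 < ((e : ℝ) - d₀) := by linarith only [h0e', he1', h12', h23', hC1', hC2', hC3', hC4', hC5', hC6']
    have f5 : 0 < ((d₀ : ℝ) + d₃ - e - d₁) := by linarith only [h0e', he1', h12', h23', hC1', hC2', hC3', hC4', hC5', hC6']
    have f6 : 0 < ((d₂ : ℝ) - e) := by linarith only [h0e', he1', h12', h23', hC1', hC2', hC3', hC4', hC5', hC6']
    have f7 : 0 < ((d₃ : ℝ) - e) := by linarith only [h0e', he1', h12', h23', hC1', hC2', hC3', hC4', hC5', hC6']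
    have f8 : 0 < ((d₂ : ℝ) + d₃ - e - d₁) := by linarith only [h0e', he1', h12', h23', hC1', hC2', hC3', hC4', hC5', hC6']
    exact mul_pos (mul_pos (mul_pos (mul_pos (mul_pos (mul_pos (mul_pos f1 f2) f3) f4) f5) f6) f7) f8
  have hPA3 : 0 < (((d₁ : ℝ) - e) * ((e : ℝ) - d₀) * ((e : ℝ) + d₂ - d₀ - d₁) * ((e : ℝ) + d₃ - d₀ - d₁) * ((d₃ : ℝ) - d₁) * ((d₂ : ℝ) - d₀) * ((d₃ : ℝ) - d₀) * ((d₂ : ℝ) + d₃ - d₀ - d₁)) := by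
    have f1 : 0 < ((d₁ : ℝ) - e) := by linarith only [h0e', he1', h12', h23', hC1', hC2', hC3', hC4', hC5', hC6']
    have f2 : 0 < ((e : ℝ) - d₀) := by linarith only [h0e', he1', h12', h23', hC1', hC2', hC3', hC4', hC5', hC6']
    have f3 : 0 < ((e : ℝ) + d₂ - d₀ - d₁) := by linarith only [h0e', he1', h12', h23', hC1', hC2', hC3', hC4', hC5', hC6']
    have f4 : 0 < ((e : ℝ) + d₃ - d₀ - d₁) := by linarith only [h0e', he1', h12', h23', hC1', hC2', hC3', hC4', hC5', hC6']
    have f5 : 0 < ((d₃ : ℝ) - d₁) := by linarith only [h0e', he1', h12', h23', hC1', hC2', hC3', hC4', hC5', hC6']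
    have f6 : 0 < ((d₂ : ℝ) - d₀) := by linarith only [h0e', he1', h12', h23', hC1', hC2', hC3', hC4', hC5', hC6']
    have f7 : 0 < ((d₃ : ℝ) - d₀) := by linarith only [h0e', he1', h12', h23', hC1', hC2', hC3', hC4', hC5', hC6']
    have f8 : 0 < ((d₂ : ℝ) + d₃ - d₀ - d₁) := by linarith only [h0e', he1', h12', h23', hC1', hC2', hC3', hC4', hC5', hC6']
    exact mul_pos (mul_pos (mul_pos (mul_pos (mul_pos (mul_pos (mul_pos f1 f2) f3) f4) f5) f6) f7) f8
  have hPC3 : 0 < (((d₂ : ℝ) - e) * ((e : ℝ) + d₁ - d₀ - d₂) * ((e : ℝ) - d₀) * ((e : ℝ) + d₃ - d₀ - d₂) * ((d₃ : ℝ) - d₂) * ((d₁ : ℝ) - d₀) * ((d₁ : ℝ) + d₃ - d₀ - d₂) * ((d₃ : ℝ) - d₀)) := by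
    have f1 : 0 < ((d₂ : ℝ) - e) := by linarith only [h0e', he1', h12', h23', hC1', hC2', hC3', hC4', hC5', hC6']
    have f2 : 0 < ((e : ℝ) + d₁ - d₀ - d₂) := by linarith only [h0e', he1', h12', h23', hC1', hC2', hC3', hC4', hC5', hC6']
    have f3 : 0 < ((e : ℝ) - d₀) := by linarith only [h0e', he1', h12', h23', hC1', hC2', hC3', hC4', hC5', hC6']
    have f4 : 0 < ((e : ℝ) + d₃ - d₀ - d₂) := by linarith only [h0e', he1', h12', h23', hC1', hC2', hC3', hC4', hC5', hC6']
    have f5 : 0 < ((d₃ : ℝ) - d₂) := by linarith only [h0e', he1', h12', h23', hC1', hC2', hC3', hC4', hC5', hC6']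
    have f6 : 0 < ((d₁ : ℝ) - d₀) := by linarith only [h0e', he1', h12', h23', hC1', hC2', hC3', hC4', hC5', hC6']
    have f7 : 0 < ((d₁ : ℝ) + d₃ - d₀ - d₂) := by linarith only [h0e', he1', h12', h23', hC1', hC2', hC3', hC4', hC5', hC6']
    have f8 : 0 < ((d₃ : ℝ) - d₀) := by linarith only [h0e', he1', h12', h23', hC1', hC2', hC3', hC4', hC5', hC6']
    exact mul_pos (mul_pos (mul_pos (mul_pos (mul_pos (mul_pos (mul_pos f1 f2) f3) f4) f5) f6) f7) f8
  have hL1 : 0 ≤ (w₀ * w₁ * D01 * (((e : ℝ) - d₀) * ((e : ℝ) + d₂ - d₀ - d₁) * ((e : ℝ) + d₃ - d₀ - d₁) * ((d₂ : ℝ) - d₁) * ((d₃ : ℝ) - d₁) * ((d₂ : ℝ) - d₀) * ((d₃ : ℝ) - d₀) * ((d₂ : ℝ) + d₃ - d₀ - d₁))) ^ (d₁ - e + (2 * e - (d₀ + d₁))) * ((((2 * e - (d₀ + d₁) : ℕ) : ℝ)) ^ (2 * e - (d₀ + d₁)) * (((d₁ - e : ℕ) : ℝ)) ^ (d₁ -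 e)) :=
    mul_nonneg (pow_nonneg (mul_nonneg (mul_nonneg (mul_nonneg hw₀.le hw₁.le) hD01.le) hPB1.le) _)
      (mul_nonneg (pow_nonneg (Nat.cast_nonneg _) _) (pow_nonneg (Nat.cast_nonneg _) _))
  have hL2 : 0 ≤ (w₀ * w₂ * D02 * (((d₂ : ℝ) - e) * ((e : ℝ) - d₀) * ((e : ℝ) + d₃ - d₀ - d₂) * ((d₂ : ℝ) - d₁) * ((d₃ : ℝ) - d₂) * ((d₁ : ℝ) - d₀) * ((d₁ : ℝ) + d₃ - d₀ - d₂) * ((d₃ : ℝ) - d₀))) ^ (d₀ + d₂ - 2 * e + (e + d₁ - (d₀ + d₂))) * ((((e + d₁ - (d₀ + d₂) : ℕ) : ℝ)) ^ (e + d₁ - (d₀ + d₂)) * (((d₀ + d₂ - 2 * e : ℕ) : ℝ)) ^ (d₀ + d₂ - 2 * e)) :=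
    mul_nonneg (pow_nonneg (mul_nonneg (mul_nonneg (mul_nonneg hw₀.le hw₂.le) hD02.le) hPB2.le) _)
      (mul_nonneg (pow_nonneg (Nat.cast_nonneg _) _) (pow_nonneg (Nat.cast_nonneg _) _))
  have hR1 : 0 ≤ (((d₁ - e + (2 * e - (d₀ + d₁)) : ℕ) : ℝ)) ^ (d₁ - e + (2 * e - (d₀ + d₁))) * ((w₀ * (-m₀) * (((d₁ : ℝ) - d₀) * ((d₂ : ℝ) - d₀) * ((d₃ : ℝ) - d₀) * ((d₂ : ℝ) - e) * ((d₃ : ℝ) - e) * ((d₁ : ℝ) + d₂ - e - d₀) * ((d₁ : ℝ) + d₃ - e - d₀) * ((d₂ : ℝ) + d₃ - e - d₀))) ^ (2 * e - (d₀ + d₁)) * ((-dJ) * (((d₁ : ℝ) - e) * ((d₂ : ℝ) - e) * ((d₃ : ℝ) - e) * ((d₀ : ℝ) + d₂ - 2 * e) * ((d₀ : ℝ) + d₃ - 2 * e) * ((d₁ : ℝ) + d₂ - 2 * e) * ((d₁ : ℝ) + d₃ - 2 * e) * ((d₂ : ℝ) + d₃ - 2 * e))) ^ (d₁ - e)) 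:=
    mul_nonneg (pow_nonneg (Nat.cast_nonneg _) _)
      (mul_nonneg (pow_nonneg (mul_nonneg (mul_nonneg hw₀.le (neg_nonneg.mpr hm₀.le)) hPA1.le) _)
        (pow_nonneg (mul_nonneg (neg_nonneg.mpr hdJ.le) hPC1.le) _))
  have hR2 : 0 ≤ (((d₀ + d₂ - 2 * e + (e + d₁ - (d₀ + d₂)) : ℕ) : ℝ)) ^ (d₀ + d₂ - 2 * e + (e + d₁ - (d₀ + d₂))) * (((-dJ) * (((e : ℝ) - d₀) * ((d₂ : ℝ) - e) * ((d₃ : ℝ) - e) * ((2 : ℝ) * e - d₀ - d₁) * ((d₀ : ℝ) + d₃ - 2 * e) * ((d₁ : ℝ) + d₂ - 2 * e) * ((d₁ : ℝ) + d₃ - 2 * e) * ((d₂ : ℝ) + d₃ - 2 * e))) ^ (e + d₁ - (d₀ + d₂)) * (w₁ * (-m₁) * (((d₁ : ℝ) - d₀) * ((d₂ : ℝ) - d₁) * ((d₃ : ℝ) - d₁) * ((e : ℝ) - d₀) * ((d₀ : ℝ) + d₃ - e - d₁) * ((d₂ : ℝ) - e) * ((d₃ : ℝ) - e) * ((d₂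 : ℝ) + d₃ - e - d₁))) ^ (d₀ + d₂ - 2 * e)) :=
    mul_nonneg (pow_nonneg (Nat.cast_nonneg _) _)
      (mul_nonneg (pow_nonneg (mul_nonneg (neg_nonneg.mpr hdJ.le) hPA2.le) _)
        (pow_nonneg (mul_nonneg (mul_nonneg hw₁.le (neg_nonneg.mpr hm₁.le)) hPC2.le) _))
  have hR3 : 0 ≤ (((2 * e - d₀ - d₁ + ((d₀ + d₂) - 2 * e) : ℕ) : ℝ)) ^ (2 * e - d₀ - d₁ + ((d₀ + d₂) - 2 * e)) * ((w₀ * w₁ * D01 * (((d₁ : ℝ) - e) * ((e : ℝ) - d₀) * ((e : ℝ) + d₂ - d₀ - d₁) * ((e : ℝ) + d₃ - d₀ - d₁) * ((d₃ : ℝ) - d₁) * ((d₂ : ℝ) - d₀) * ((d₃ : ℝ) - d₀) * ((d₂ : ℝ) + d₃ - d₀ - d₁))) ^ ((d₀ + d₂) - 2 * e) * (w₀ * w₂ * D02 * (((d₂ : ℝ) - e) * ((e : ℝ) + d₁ - d₀ - d₂) * ((e : ℝ) - d₀) * ((e : ℝ) + d₃ - d₀ - d₂) * ((d₃ : ℝ)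 - d₂) * ((d₁ : ℝ) - d₀) * ((d₁ : ℝ) + d₃ - d₀ - d₂) * ((d₃ : ℝ) - d₀))) ^ (2 * e - d₀ - d₁)) :=
    mul_nonneg (pow_nonneg (Nat.cast_nonneg _) _)
      (mul_nonneg (pow_nonneg (mul_nonneg (mul_nonneg (mul_nonneg hw₀.le hw₁.le) hD01.le) hPA3.le) _)
        (pow_nonneg (mul_nonneg (mul_nonneg (mul_nonneg hw₀.le hw₂.le) hD02.le) hPC3.le) _))
  -- KEY: the weighted product with the weights restored, from `hcomb` times the weight monomial
  have key : ((w₀ * w₁ * D01 * (((e : ℝ) - d₀) * ((e : ℝ) + d₂ - d₀ - d₁) * ((e : ℝ) + d₃ - d₀ - d₁) * ((d₂ : ℝ) - d₁) * ((d₃ : ℝ) - d₁) * ((d₂ : ℝ) - d₀) * ((d₃ : ℝ) - d₀) * ((d₂ : ℝ) + d₃ - d₀ - d₁))) ^ (d₁ - e + (2 * e - (d₀ + d₁))) * ((((2 * e - (d₀ + d₁) : ℕ) : ℝ)) ^ (2 * e - (d₀ + d₁)) * (((d₁ - e : ℕ) : ℝ)) ^ (d₁ - e))) ^ (d₀ +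 d₂ - 2 * e) * ((w₀ * w₂ * D02 * (((d₂ : ℝ) - e) * ((e : ℝ) - d₀) * ((e : ℝ) + d₃ - d₀ - d₂) * ((d₂ : ℝ) - d₁) * ((d₃ : ℝ) - d₂) * ((d₁ : ℝ) - d₀) * ((d₁ : ℝ) + d₃ - d₀ - d₂) * ((d₃ : ℝ) - d₀))) ^ (d₀ + d₂ - 2 * e + (e + d₁ - (d₀ + d₂))) * ((((e + d₁ - (d₀ + d₂) : ℕ) : ℝ)) ^ (e + d₁ - (d₀ + d₂)) * (((d₀ + d₂ - 2 * e : ℕ) : ℝ)) ^ (d₀ + d₂ - 2 * e))) ^ (2 * e - (d₀ + d₁)) * (((-dJ) * (((e : ℝ) - d₀) * ((d₁ : ℝ) - e) * ((d₂ : ℝ) - e) * ((d₃ : ℝ) - e) * ((d₀ : ℝ) + d₃ - 2 * e) * ((d₁ : ℝ) + d₂ - 2 * e) * ((d₁ : ℝ) + d₃ - 2 * e) * ((d₂ : ℝ) + d₃ - 2 * e))) ^ (2 * e - d₀ - d₁ + ((d₀ + d₂) - 2 * e)) * (((((d₀ + d₂) - 2 * e : ℕ) : ℝ)) ^ ((d₀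 + d₂) - 2 * e) * (((2 * e - d₀ - d₁ : ℕ) : ℝ)) ^ (2 * e - d₀ - d₁))) ^ (d₁ - e)
      < ((((d₁ - e + (2 * e - (d₀ + d₁)) : ℕ) : ℝ)) ^ (d₁ - e + (2 * e - (d₀ + d₁))) * ((w₀ * (-m₀) * (((d₁ : ℝ) - d₀) * ((d₂ : ℝ) - d₀) * ((d₃ : ℝ) - d₀) * ((d₂ : ℝ) - e) * ((d₃ : ℝ) - e) * ((d₁ : ℝ) + d₂ - e - d₀) * ((d₁ : ℝ) + d₃ - e - d₀) * ((d₂ : ℝ) + d₃ - e - d₀))) ^ (2 * e - (d₀ + d₁)) * ((-dJ) * (((d₁ : ℝ) - e) * ((d₂ : ℝ) - e) * ((d₃ : ℝ) - e) * ((d₀ : ℝ) + d₂ - 2 * e) * ((d₀ : ℝ) + d₃ - 2 * e) * ((d₁ : ℝ) + d₂ - 2 * e) * ((d₁ : ℝ) + d₃ - 2 * e) * ((d₂ : ℝ) + d₃ - 2 * e))) ^ (d₁ - e))) ^ (d₀ + d₂ - 2 * e) * ((((d₀ + d₂ - 2 * e + (e + d₁ - (d₀ + d₂)) : ℕ) :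 ℝ)) ^ (d₀ + d₂ - 2 * e + (e + d₁ - (d₀ + d₂))) * (((-dJ) * (((e : ℝ) - d₀) * ((d₂ : ℝ) - e) * ((d₃ : ℝ) - e) * ((2 : ℝ) * e - d₀ - d₁) * ((d₀ : ℝ) + d₃ - 2 * e) * ((d₁ : ℝ) + d₂ - 2 * e) * ((d₁ : ℝ) + d₃ - 2 * e) * ((d₂ : ℝ) + d₃ - 2 * e))) ^ (e + d₁ - (d₀ + d₂)) * (w₁ * (-m₁) * (((d₁ : ℝ) - d₀) * ((d₂ : ℝ) - d₁) * ((d₃ : ℝ) - d₁) * ((e : ℝ) - d₀) * ((d₀ : ℝ) + d₃ - e - d₁) * ((d₂ : ℝ) - e) * ((d₃ : ℝ) - e) * ((d₂ : ℝ) + d₃ - e - d₁))) ^ (d₀ + d₂ - 2 * e))) ^ (2 * e - (d₀ + d₁)) * ((((2 * e - d₀ - d₁ + ((d₀ + d₂) - 2 * e) : ℕ) : ℝ)) ^ (2 * e - d₀ - d₁ + ((d₀ + d₂) - 2 * e)) * ((w₀ * w₁ * D01 * (((d₁ : ℝ) - e) * ((e : ℝ) - d₀) * ((e : ℝ) + d₂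 - d₀ - d₁) * ((e : ℝ) + d₃ - d₀ - d₁) * ((d₃ : ℝ) - d₁) * ((d₂ : ℝ) - d₀) * ((d₃ : ℝ) - d₀) * ((d₂ : ℝ) + d₃ - d₀ - d₁))) ^ ((d₀ + d₂) - 2 * e) * (w₀ * w₂ * D02 * (((d₂ : ℝ) - e) * ((e : ℝ) + d₁ - d₀ - d₂) * ((e : ℝ) - d₀) * ((e : ℝ) + d₃ - d₀ - d₂) * ((d₃ : ℝ) - d₂) * ((d₁ : ℝ) - d₀) * ((d₁ : ℝ) + d₃ - d₀ - d₂) * ((d₃ : ℝ) - d₀))) ^ (2 * e - d₀ - d₁))) ^ (d₁ - e) := by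
    have Wpos : 0 < w₀ ^ ((2 * e - (d₀ + d₁)) * (d₀ + d₂ - 2 * e) + (d₀ + d₂ - 2 * e) * (d₁ - e) + (2 * e - (d₀ + d₁)) * (d₁ - e)) * w₁ ^ (((d₁ - e) + (2 * e - (d₀ + d₁))) * (d₀ + d₂ - 2 * e)) * w₂ ^ (((d₀ + d₂ - 2 * e) + (e + d₁ - (d₀ + d₂))) * (2 * e - (d₀ + d₁))) := by positivity
    have h := mul_lt_mul_of_pos_left hcomb Wpos
    have hCJ : 2 * e - d₀ - d₁ = 2 * e - (d₀ + d₁) := by omega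
    have hA : d₁ - e = d₀ + d₂ - 2 * e + (e + d₁ - (d₀ + d₂)) := by omega
    rw [hCJ] at h ⊢
    rw [hA] at h ⊢
    generalize (((e : ℝ) - d₀) * ((e : ℝ) + d₂ - d₀ - d₁) * ((e : ℝ) + d₃ - d₀ - d₁) * ((d₂ : ℝ) - d₁) * ((d₃ : ℝ) - d₁) * ((d₂ : ℝ) - d₀) * ((d₃ : ℝ) - d₀) * ((d₂ : ℝ) + d₃ - d₀ - d₁)) = PB1 at h ⊢
    generalize (((d₁ : ℝ) - d₀) * ((d₂ : ℝ) - d₀) * ((d₃ : ℝ) - d₀) * ((d₂ : ℝ) - e) * ((d₃ : ℝ) - e) * ((d₁ : ℝ) + d₂ - e - d₀) * ((d₁ : ℝ) + d₃ - e - d₀) * ((d₂ : ℝ) + d₃ - e - d₀)) = PA1 at h ⊢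
    generalize (((d₁ : ℝ) - e) * ((d₂ : ℝ) - e) * ((d₃ : ℝ) - e) * ((d₀ : ℝ) + d₂ - 2 * e) * ((d₀ : ℝ) + d₃ - 2 * e) * ((d₁ : ℝ) + d₂ - 2 * e) * ((d₁ : ℝ) + d₃ - 2 * e) * ((d₂ : ℝ) + d₃ - 2 * e)) = PC1 at h ⊢
    generalize (((d₂ : ℝ) - e) * ((e : ℝ) - d₀) * ((e : ℝ) + d₃ - d₀ - d₂) * ((d₂ : ℝ) - d₁) * ((d₃ : ℝ) - d₂) * ((d₁ : ℝ) - d₀) * ((d₁ : ℝ) + d₃ - d₀ - d₂) * ((d₃ : ℝ) - d₀)) = PB2 at h ⊢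
    generalize (((e : ℝ) - d₀) * ((d₂ : ℝ) - e) * ((d₃ : ℝ) - e) * ((2 : ℝ) * e - d₀ - d₁) * ((d₀ : ℝ) + d₃ - 2 * e) * ((d₁ : ℝ) + d₂ - 2 * e) * ((d₁ : ℝ) + d₃ - 2 * e) * ((d₂ : ℝ) + d₃ - 2 * e)) = PA2 at h ⊢
    generalize (((d₁ : ℝ) - d₀) * ((d₂ : ℝ) - d₁) * ((d₃ : ℝ) - d₁) * ((e : ℝ) - d₀) * ((d₀ : ℝ) + d₃ - e - d₁) * ((d₂ : ℝ) - e) * ((d₃ : ℝ) - e) * ((d₂ : ℝ) + d₃ - e - d₁)) = PC2 at h ⊢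
    generalize (((e : ℝ) - d₀) * ((d₁ : ℝ) - e) * ((d₂ : ℝ) - e) * ((d₃ : ℝ) - e) * ((d₀ : ℝ) + d₃ - 2 * e) * ((d₁ : ℝ) + d₂ - 2 * e) * ((d₁ : ℝ) + d₃ - 2 * e) * ((d₂ : ℝ) + d₃ - 2 * e)) = PB3 at h ⊢
    generalize (((d₁ : ℝ) - e) * ((e : ℝ) - d₀) * ((e : ℝ) + d₂ - d₀ - d₁) * ((e : ℝ) + d₃ - d₀ - d₁) * ((d₃ : ℝ) - d₁) * ((d₂ : ℝ) - d₀) * ((d₃ : ℝ) - d₀) * ((d₂ : ℝ) + d₃ - d₀ - d₁)) = PA3 at h ⊢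
    generalize (((d₂ : ℝ) - e) * ((e : ℝ) + d₁ - d₀ - d₂) * ((e : ℝ) - d₀) * ((e : ℝ) + d₃ - d₀ - d₂) * ((d₃ : ℝ) - d₂) * ((d₁ : ℝ) - d₀) * ((d₁ : ℝ) + d₃ - d₀ - d₂) * ((d₃ : ℝ) - d₀)) = PC3 at h ⊢
    generalize -m₀ = n₀ at h ⊢
    generalize -m₁ = n₁ at h ⊢
    generalize -dJ = nJ at h ⊢
    generalize d₀ + d₂ - 2 * e = D at h ⊢
    generalize e + d₁ - (d₀ + d₂) = E at h ⊢
    generalize 2 * e - (d₀ + d₁) = Q at h ⊢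
    generalize ((D + E + Q : ℕ) : ℝ) = S₁ at h ⊢
    generalize ((D + E : ℕ) : ℝ) = S₂ at h ⊢
    generalize ((Q + D : ℕ) : ℝ) = S₃ at h ⊢
    generalize ((Q : ℕ) : ℝ) = cQ at h ⊢
    generalize ((D : ℕ) : ℝ) = cD at h ⊢
    generalize ((E : ℕ) : ℝ) = cE at h ⊢
    convert h using 1 <;> first | rfl | ring
  exact elevenNomial_chamberC_CJ_le_eight e d₀ d₁ d₂ d₃ h0e he1 h12 h23 hC1 hC2 hC3 dJ m₀ m₁ m₂ m₃ w₀ w₁ w₂ w₃ D01 D02 D03 D12 D13 D23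
    hw₀ hw₁ hw₂ hD01 hD02
    (circuitRay_transfer_three (m₁ := d₀ + d₂ - 2 * e) (m₂ := 2 * e - (d₀ + d₁)) (m₃ := d₁ - e) hL1 hL2 hR1 hR2 hR3 hN1 hN2 key)

/-- **Rank-one `(2,4)₁`, split 1/3, chamber (C): `Z₊ ≤ 8` under the weight-free circuit triple «N01 ∨ N02 ∨ C_J»** (matrix form; `J` any
real `2 × 2` matrix with `det J < 0`, letters `0, 1` core, letters `0,1` and `0,2` not parallel). [this file] -/
theorem oneThree_rankOne_posRoots_le_eight_of_N01N02CJ (e d₀ d₁ d₂ d₃ : ℕ) (h0e : d₀ < e) (he1 : e < d₁) (h12 : d₁ < d₂)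
    (h23 : d₂ < d₃) (hC1 : d₀ + d₁ < 2 * e) (hC2 : 2 * e < d₀ + d₂) (hC3 : d₀ + d₂ < e + d₁) (hC4 : e + d₁ < d₀ + d₃)
    (hC5 : d₀ + d₃ < e + d₂) (hC6 : d₁ + d₂ < e + d₃)
    (J : Matrix (Fin 2) (Fin 2) ℝ) (v₀ v₁ v₂ v₃ : Fin 2 → ℝ) (w₀ w₁ w₂ w₃ : ℝ) (hw₀ : 0 < w₀) (hw₁ : 0 < w₁) (hw₂ : 0 < w₂)
    (hm₀ : (J 0 0 * v₀ 1 ^ 2 + J 1 1 * v₀ 0 ^ 2 - (J 0 1 + J 1 0) * (v₀ 0 * v₀ 1)) < 0)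
    (hm₁ : (J 0 0 * v₁ 1 ^ 2 + J 1 1 * v₁ 0 ^ 2 - (J 0 1 + J 1 0) * (v₁ 0 * v₁ 1)) < 0) (hdJ : J.det < 0)
    (hD01 : 0 < (v₀ 0 * v₁ 1 - v₀ 1 * v₁ 0) ^ 2) (hD02 : 0 < (v₀ 0 * v₂ 1 - v₀ 1 * v₂ 0) ^ 2)
    (hcomb : ((((v₀ 0 * v₁ 1 - v₀ 1 * v₁ 0) ^ 2) * (((e : ℝ) - d₀) * ((e : ℝ) + d₂ - d₀ - d₁) * ((e : ℝ) + d₃ - d₀ - d₁) * ((d₂ : ℝ) - d₁) * ((d₃ : ℝ) - d₁) * ((d₂ : ℝ) - d₀) * ((d₃ : ℝ) - d₀) * ((d₂ : ℝ) + d₃ - d₀ - d₁))) ^ (d₁ - e + (2 * e - (d₀ + d₁))) * ((((2 * e - (d₀ + d₁) : ℕ) : ℝ)) ^ (2 * e - (d₀ + d₁)) * (((d₁ - e : ℕ) : ℝ)) ^ (d₁ - e))) ^ (d₀ + d₂ - 2 * e) * ((((v₀ 0 * v₂ 1 - v₀ 1 * v₂ 0) ^ 2) * (((d₂ : ℝ)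 - e) * ((e : ℝ) - d₀) * ((e : ℝ) + d₃ - d₀ - d₂) * ((d₂ : ℝ) - d₁) * ((d₃ : ℝ) - d₂) * ((d₁ : ℝ) - d₀) * ((d₁ : ℝ) + d₃ - d₀ - d₂) * ((d₃ : ℝ) - d₀))) ^ (d₀ + d₂ - 2 * e + (e + d₁ - (d₀ + d₂))) * ((((e + d₁ - (d₀ + d₂) : ℕ) : ℝ)) ^ (e + d₁ - (d₀ + d₂)) * (((d₀ + d₂ - 2 * e : ℕ) : ℝ)) ^ (d₀ + d₂ - 2 * e))) ^ (2 * e - (d₀ + d₁)) * (((-J.det) * (((e : ℝ) - d₀) * ((d₁ : ℝ) - e) * ((d₂ : ℝ) - e) * ((d₃ : ℝ) - e) * ((d₀ : ℝ) + d₃ - 2 * e) * ((d₁ : ℝ) + d₂ - 2 * e) * ((d₁ : ℝ) + d₃ - 2 * e) * ((d₂ : ℝ) + d₃ - 2 * e))) ^ (2 * e - d₀ - d₁ + ((d₀ + d₂) - 2 * e)) * (((((d₀ + d₂) - 2 * e : ℕ) : ℝ)) ^ ((d₀ + d₂) - 2 * e) * (((2 * e - d₀ - d₁ : ℕ) : ℝ))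 ^ (2 * e - d₀ - d₁))) ^ (d₁ - e)
      < ((((d₁ - e + (2 * e - (d₀ + d₁)) : ℕ) : ℝ)) ^ (d₁ - e + (2 * e - (d₀ + d₁))) * (((-(J 0 0 * v₀ 1 ^ 2 + J 1 1 * v₀ 0 ^ 2 - (J 0 1 + J 1 0) * (v₀ 0 * v₀ 1))) * (((d₁ : ℝ) - d₀) * ((d₂ : ℝ) - d₀) * ((d₃ : ℝ) - d₀) * ((d₂ : ℝ) - e) * ((d₃ : ℝ) - e) * ((d₁ : ℝ) + d₂ - e - d₀) * ((d₁ : ℝ) + d₃ - e - d₀) * ((d₂ : ℝ) + d₃ - e - d₀))) ^ (2 * e - (d₀ + d₁)) * ((-J.det) * (((d₁ : ℝ) - e) * ((d₂ : ℝ) - e) * ((d₃ : ℝ) - e) * ((d₀ : ℝ) + d₂ - 2 * e) * ((d₀ : ℝ) + d₃ - 2 * e) * ((d₁ : ℝ) + d₂ - 2 * e) * ((d₁ : ℝ) + d₃ - 2 * e) * ((d₂ : ℝ) + d₃ - 2 * e))) ^ (d₁ - e))) ^ (d₀ + d₂ - 2 * e) * ((((d₀ + d₂ - 2 * e + (e +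 d₁ - (d₀ + d₂)) : ℕ) : ℝ)) ^ (d₀ + d₂ - 2 * e + (e + d₁ - (d₀ + d₂))) * (((-J.det) * (((e : ℝ) - d₀) * ((d₂ : ℝ) - e) * ((d₃ : ℝ) - e) * ((2 : ℝ) * e - d₀ - d₁) * ((d₀ : ℝ) + d₃ - 2 * e) * ((d₁ : ℝ) + d₂ - 2 * e) * ((d₁ : ℝ) + d₃ - 2 * e) * ((d₂ : ℝ) + d₃ - 2 * e))) ^ (e + d₁ - (d₀ + d₂)) * ((-(J 0 0 * v₁ 1 ^ 2 + J 1 1 * v₁ 0 ^ 2 - (J 0 1 + J 1 0) * (v₁ 0 * v₁ 1))) * (((d₁ : ℝ) - d₀) * ((d₂ : ℝ) - d₁) * ((d₃ : ℝ) - d₁) * ((e : ℝ) - d₀) * ((d₀ : ℝ) + d₃ - e - d₁) * ((d₂ : ℝ) - e) * ((d₃ : ℝ) - e) * ((d₂ : ℝ) + d₃ - e - d₁))) ^ (d₀ + d₂ - 2 * e))) ^ (2 * e - (d₀ + d₁)) * ((((2 * e - d₀ - d₁ + ((d₀ + d₂) - 2 * e) : ℕ) : ℝ)) ^ (2 * e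 - d₀ - d₁ + ((d₀ + d₂) - 2 * e)) * ((((v₀ 0 * v₁ 1 - v₀ 1 * v₁ 0) ^ 2) * (((d₁ : ℝ) - e) * ((e : ℝ) - d₀) * ((e : ℝ) + d₂ - d₀ - d₁) * ((e : ℝ) + d₃ - d₀ - d₁) * ((d₃ : ℝ) - d₁) * ((d₂ : ℝ) - d₀) * ((d₃ : ℝ) - d₀) * ((d₂ : ℝ) + d₃ - d₀ - d₁))) ^ ((d₀ + d₂) - 2 * e) * (((v₀ 0 * v₂ 1 - v₀ 1 * v₂ 0) ^ 2) * (((d₂ : ℝ) - e) * ((e : ℝ) + d₁ - d₀ - d₂) * ((e : ℝ) - d₀) * ((e : ℝ) + d₃ - d₀ - d₂) * ((d₃ : ℝ) - d₂) * ((d₁ : ℝ) - d₀) * ((d₁ : ℝ) + d₃ - d₀ - d₂) * ((d₃ : ℝ) - d₀))) ^ (2 * e - d₀ - d₁))) ^ (d₁ - e)) :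
    ((Matrix.det (((X : ℝ[X]) ^ e) • J.map Polynomial.C
        + (Polynomial.C w₀ * X ^ d₀) • (vecMulVec v₀ v₀).map Polynomial.C
        + (Polynomial.C w₁ * X ^ d₁) • (vecMulVec v₁ v₁).map Polynomial.C
        + (Polynomial.C w₂ * X ^ d₂) • (vecMulVec v₂ v₂).map Polynomial.C
        + (Polynomial.C w₃ * X ^ d₃) • (vecMulVec v₃ v₃).map Polynomial.C)).roots.toFinset.filter (fun t => 0 < t)).card
      ≤ 8 := by
  rw [det_rankOne_four_sum]
  exact elevenNomial_chamberC_N01N02CJ_le_eight e d₀ d₁ d₂ d₃ h0e he1 h12 h23 hC1 hC2 hC3 hC4 hC5 hC6 J.det _ _ _ _ w₀ w₁ w₂ w₃ _ _ _ _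
    _ _ hw₀ hw₁ hw₂ hm₀ hm₁ hdJ hD01 hD02 hcomb

end Summit.ValiantsHypothesis.ValiantsHypothesis.Theorems.LacunarySymmetroidMatrixDescartes.Pivot.TwoDirections.BlockLaw
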